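/-
Copyright (c) 2026 the pub-hodgecm-mathlib formalisation cell (harness21).  Prover seat hodgecm-mathlib-LD1-p02 (g4), organ payer of half-A line LD1
(crux `hLiu418`), brick (Gα-C∞) `ArchLadder`, plate (P4) «ι-step» (dealer LD1-plan (g2) DEALS #10 ∕ #10-bis 2026-09-02; HEAD owner A-p16 (g35)).
THEOREMS ONLY (no definition, no named fact, no `sorry`, no instance, no notation).  `--supports stmt-HodgeConjecture-24832 --as helper`.
-/
import Summits.HodgeConjecture.HodgeConjecture.Theorems.F0LD1ThetaArchCompactStep
import Literature.NumberTheory.GelbartRogawski1991.DoubledWeilRepresentationArchPlaceBoostBox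
import HarnessLib

-- statements over the theta-kernel datum elaborate to very large types; elaborate sequentially (as in the ★ kit lineage)
set_option Elab.async false

/-!
# (Gα-C∞, ι-step) A BOOST of the hyperbolic plane at the INDEFINITE place acts on a Hermite theta class through the transported hyperbolic family
# `B_t` of its Folland frame; the torus projector then EXTRACTS the boosted Hermite coefficient, which is non-zero for SOME boost along the ladder
# `β ↦ β ± (e_{(k₊,v₀)} + e_{(k₋,v₀)})` (line LD1 of crux HLiu418, brick (Gα-C∞) `ArchLadder`, plate (P4); pen LD1-p02 (g4))

Cell hodgecm-mathlib, floor 0; namespace `Summit.HodgeConjecture.HodgeConjecture.Cruxes.HLiu418.F0LD1ThetaArchLadderIotaStep`;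
`--supports stmt-HodgeConjecture-24832 --as helper`.  THEOREMS ONLY (no definition, no instance, no notation, no `sorry`).

THE POINT (the NON-compact twin of ★ `F0LD1ThetaArchCompactStep`).  Let `v₀` be a real place of `L⁺`, `k₊, k₋ : Fin n′` two coordinates of the pair space with
`x_{v₀}(k₊) > 0`, `¬ x_{v₀}(k₋) > 0` (the hyperbolic plane of `V ⊗ W` at the place of `ι`), `u ∈ U(σ_{w₀} diag dV)(ℂ)` the boost of parameter `t` of that
plane (its scaled-frame matrix `D (u ⊗ 1)^{e₁} D⁻¹` is `!![ch t, −i sh t; i sh t, ch t]` on `{k₊, k₋}` and `1` elsewhere: hypothesis `hu`), `k ∈ U(H)(𝔸)` with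
`ιA k = adelicSingle w₀ u`, and `B_t = reindexEquiv archIdx_V (hypOpEquiv t)` the hyperbolic family of the pair junction (★ `JunctionHyperbolicFamily.hypOp`)
transported to the Folland coordinates `Fin n′ × places` (★ `JunctionHyperbolicReindex`).  Then
* §1 **`rightRegular_toLp_lineThetaLift_follandHermite_of_boost`**: `R(k) [θ_{h_β ⊗ Φ_f}] = (η_D(k_{v₀,u}) · c) • [θ_{(B_t)^{frameV} h_β ⊗ Φ_f}]` in
  `L²([U(H)], ν)` (★ K1 `rightRegular_toLp_lineThetaLift`, ★ T2 `pairRep_chiSplittingLine_adelicSingle_tmul_of_box` fed by ★ the box identity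
  `carrierConjEquiv_frameD_sectionD_archKPlace_of_boost`; `c = C(weilHomV a_t) ∕ C(hypOp t)` unimodular);
* §2 `hermiteCoeff_carrierConjEquiv_follandHermite` — the Folland-frame Hermite coefficients of `(S)^{frameV} h_β` are `c_γ(S h_β)` (`piCoeff`); hence
  **`charProjL_rightRegular_thetaClass_follandHermite_of_boost`**: the full-torus projector of type `c_γ` sends `R(k) [θ_{h_β ⊗ Φ_f}]` to
  `(η · c · c_γ(B_t h_β)) • [θ_{h_γ ⊗ Φ_f}]` (★ `charProjL_thetaClass_eq_coeff_smul_of_hasSum_thetaClass`, ★ `hasSum_follandCoeff_smul_thetaClass_follandHermite`);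
* §3 **`thetaClass_follandHermite_mem_of_boostCoeff_ne_zero`** — ONE BOOST STEP: `Q` closed `R`-invariant, `[θ_{h_β ⊗ Φ_f}] ∈ Q` and `c_γ(B_t h_β) ≠ 0`
  ⇒ `[θ_{h_γ ⊗ Φ_f}] ∈ Q` (the projector preserves `Q`, ★ `charProj_restrict_mem_closedSubrep`; `η · c ≠ 0`);
* §4 **`iotaStep`** — THE ι-STEP in the shape agreed with the HEAD owner (A-p16 (g35) a011): over the data of ★ `F0LD1ThetaArchDefiniteTransitivity` (pin
  `hpin`, automorphic `ν`), a hyperbolic pair `(k₊, k₋)` at `v₀` and boosts `u_t` for all `t` (`hU`, the indefinite twin of ★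
  `exists_archLocal_entries_eq_of_pos`): `[θ_{h_β ⊗ Φ_f}] ∈ Q ⇒ [θ_{h_{β + e_{(k₊,v₀)} + e_{(k₋,v₀)}} ⊗ Φ_f}] ∈ Q`, and `⇒ [θ_{h_{β − …}} ⊗ Φ_f}] ∈ Q` when
  `β(k₊,v₀), β(k₋,v₀) ≥ 1` — SOME `t` has `c_{β±d}(B_t h_β) ≠ 0` by the ladder ★ `exists_piCoeff_add∕sub_reindex_hypOp_hermitePi_ne_zero` (Folland's
  `U(1,1)`-ladder: the derivative at `t = 0` of the Hermite coefficient is `−i√((β_{k₊}+1)(β_{k₋}+1)) ≠ 0`).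
Nothing printed is discharged; HC_CM is proved only modulo the 7 printed citations (2 remaining: hLiu418 = stmt-HodgeConjecture-24832, h413 =
stmt-HodgeConjecture-24833) until rung 0 closes; count-neutral.

References (prose locators): Folland 1989 §1.7 (1.82), §4.2 (4.24), Prop. (4.39), §4.4 Thm. (4.37); Kashiwara–Vergne 1978 §6; Howe 1989 §3;
Konno–Konno 2007 §3.3, Thm. 5.4; Bröcker–tom Dieck 1985 III (5.10); Borel–Jacquet 1979 §4.6.
-/

set_option autoImplicit false
set_option linter.dupNamespace false

noncomputable section

open NumberField NumberField.InfinitePlace MeasureTheory IsDedekindDomain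
open scoped Matrix ComplexOrder ENNReal TensorProduct SchwartzMap Kronecker Classical ComplexConjugate InnerProductSpace

namespace Summit.HodgeConjecture.HodgeConjecture.Cruxes.HLiu418.F0LD1ThetaArchLadderIotaStep

open _root_.MeasureTheory
open Literature.NumberTheory.Automorphic Literature.NumberTheory.Automorphic.UnitaryGroup
open Literature.NumberTheory.Automorphic.UnitaryGroup.CotangentForms
open Literature.NumberTheory.Automorphic.IdeleClassGroup
open Literature.NumberTheory.Automorphic.Liu2021
open Literature.NumberTheory.Automorphic.Liu2021.Def411WeilCarriers
open Literature.NumberTheory.Automorphic.Liu2021.Def411WeilCarriersDoubling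
open Literature.NumberTheory.Automorphic.Liu2021.CinfThetaTorus
open Literature.NumberTheory.GelbartRogawski1991 Literature.NumberTheory.GelbartRogawski1991.UnitaryDualPair
open Literature.NumberTheory.GelbartRogawski1991.GRConstruction
open Literature.NumberTheory.Weil1964 Literature.NumberTheory.Weil1964.MpS Literature.NumberTheory.Weil1964.UnitaryWeil
open Literature.RepresentationTheory.Liu2021
open Literature.RepresentationTheory.HeisenbergGroup Literature.Analysis.SegalBargmann
open Literature.RepresentationTheory.KonnoKonno2007 Literature.RepresentationTheory.KonnoKonno2007.RealDualPair
open Literature.RepresentationTheory.CompactGroups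
open Summit.HodgeConjecture.HodgeConjecture.Cruxes.HLiu418.F0LD1ThetaTransportKit
open Summit.HodgeConjecture.HodgeConjecture.Cruxes.HLiu418.F0LD2ThetaTensorClasses
open Summit.HodgeConjecture.HodgeConjecture.Cruxes.HLiu418.F0LD2ThetaTorusEigenclass
open Summit.HodgeConjecture.HodgeConjecture.Cruxes.HLiu418.F0LD1ArchTorusHom
open Summit.HodgeConjecture.HodgeConjecture.Cruxes.HLiu418.F0LD1ThetaClassTorusExtraction
open Summit.HodgeConjecture.HodgeConjecture.Cruxes.HLiu418.F0LD1ThetaClassHermiteSum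
open Summit.HodgeConjecture.HodgeConjecture.Cruxes.HLiu418.F0LD1ThetaSliceTorusProjector (charProj_restrict_mem_closedSubrep exists_charRep_prod_prod_zpow)
open Summit.HodgeConjecture.HodgeConjecture.Cruxes.HLiu418.F0LD2PinnedArchSingleTransport (exists_archLocal_pin_adelicSingle_eq)

/-! ## §2′ (generic) The Folland-frame Hermite coefficients of a transported vector are the junction's `piCoeff` -/

section Coeff

variable {σ : Type*} [Fintype σ] [DecidableEq σ] {D : Type*} [NormedAddCommGroup D] [NormedSpace ℝ D]

/-- **`c_γ((S)^{e} h_β) = piCoeff γ (S h_β)`**: the Folland-frame Hermite coefficients of `frameV^* S (frameV^*)⁻¹ h^V_β` are the Hermite coefficients of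
`S h_β` on `𝓢(ℝ^σ)` (★ `schwartzTransport_follandHermite`; `piCoeff` unfolded). [cite: Folland1989, §1.7 (1.81)] -/
theorem hermiteCoeff_carrierConjEquiv_follandHermite (e : D ≃L[ℝ] (σ → ℝ)) (S : SchwartzMap (σ → ℝ) ℂ ≃L[ℂ] SchwartzMap (σ → ℝ) ℂ) (γ β : σ →₀ ℕ) :
    hermiteCoeff γ ((schwartzTransport (euclE σ)).symm (schwartzTransport e (carrierConjEquiv e S (follandHermite e β)))) =
      piCoeff γ (S (hermitePi β)) := by
  rw [carrierConjEquiv_apply, ContinuousLinearEquiv.apply_symm_apply, schwartzTransport_follandHermite]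
  rfl

end Coeff

/-! ## §1 The class identity: `R(k) [θ_{h_β ⊗ Φ_f}] = (η_D(k_{v₀,u}) · c) • [θ_{(B_t)^{frameV} h_β ⊗ Φ_f}]` -/

section Covariance

variable (L : Type) [Field L] [NumberField L] [IsCMField L] (N : ℕ) (H : Matrix (Fin N) (Fin N) L)
  {n' : ℕ} (e₁ : Fin N × Fin 1 ≃ Fin n') (dV : Fin N → L) (hdV : ∀ i, IsCMField.complexConj L (dV i) = dV i)
  (hdV0 : ∀ i, dV i ≠ 0)
  (ιA : (adelicGroupData (↥(maximalRealSubfield L)) L (IsCMField.complexConj L) N H).Adelic →*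
    ↥(UnitaryGroup.adelic (↥(maximalRealSubfield L)) L (IsCMField.complexConj L) N (Matrix.diagonal dV)))
  (hιA : Continuous ιA ∧ ∀ ⦃γ : (adelicGroupData (↥(maximalRealSubfield L)) L (IsCMField.complexConj L) N H).Adelic⦄,
    γ ∈ (UnitaryGroup.toAdelic (↥(maximalRealSubfield L)) L (IsCMField.complexConj L) N H).range →
      ιA γ ∈ (UnitaryGroup.toAdelic (↥(maximalRealSubfield L)) L (IsCMField.complexConj L) N (Matrix.diagonal dV)).range)
  (μ : Literature.NumberTheory.Automorphic.IdeleClassGroup L →ₜ* Circle) (hμ : IsConjugateSymplectic L μ) (a : (↥(maximalRealSubfield L))ˣ)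
  (hρ : HasThetaMajorants fun
      (p : ↥(UnitaryGroup.adelic (↥(maximalRealSubfield L)) L (IsCMField.complexConj L) N (Matrix.diagonal dV)) ×
        ↥(UnitaryGroup.adelic (↥(maximalRealSubfield L)) L (IsCMField.complexConj L) 1 (JW (↥(maximalRealSubfield L)) L a)))
      (Φ : piSchwartzBruhat (↥(maximalRealSubfield L)) (Fin n')) =>
        pairRep (↥(maximalRealSubfield L)) L (IsCMField.complexConj L) N 1 e₁ (Matrix.diagonal dV) (JW (↥(maximalRealSubfield L)) L a)
          (chiSplittingLine L e₁ dV hdV hdV0 (toHeckeCharacter L μ) (isUnitary_toHeckeCharacter L μ)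
            ((isOscillatorChar_toHeckeCharacter_iff μ).mpr hμ) (TW (↥(maximalRealSubfield L)) a)
            (isUnit_det_TW (↥(maximalRealSubfield L)) a) (JW (↥(maximalRealSubfield L)) L a) (JW_eq (↥(maximalRealSubfield L)) L a))
          p Φ)
  [CompactSpace (↥(UnitaryGroup.adelic (↥(maximalRealSubfield L)) L (IsCMField.complexConj L) N (Matrix.diagonal dV)) ⧸
    (UnitaryGroup.toAdelic (↥(maximalRealSubfield L)) L (IsCMField.complexConj L) N (Matrix.diagonal dV)).range)]
  [MeasurableSpace (↥(UnitaryGroup.adelic (↥(maximalRealSubfield L)) L (IsCMField.complexConj L) 1 (JW (↥(maximalRealSubfield L)) L a)) ⧸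
    (UnitaryGroup.toAdelic (↥(maximalRealSubfield L)) L (IsCMField.complexConj L) 1 (JW (↥(maximalRealSubfield L)) L a)).range)]
  (μW : Measure (↥(UnitaryGroup.adelic (↥(maximalRealSubfield L)) L (IsCMField.complexConj L) 1 (JW (↥(maximalRealSubfield L)) L a)) ⧸
    (UnitaryGroup.toAdelic (↥(maximalRealSubfield L)) L (IsCMField.complexConj L) 1 (JW (↥(maximalRealSubfield L)) L a)).range))
  (f : C((↥(UnitaryGroup.adelic (↥(maximalRealSubfield L)) L (IsCMField.complexConj L) 1 (JW (↥(maximalRealSubfield L)) L a)) ⧸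
    (UnitaryGroup.toAdelic (↥(maximalRealSubfield L)) L (IsCMField.complexConj L) 1 (JW (↥(maximalRealSubfield L)) L a)).range), ℂ))
  [BorelSpace (↥(UnitaryGroup.adelic (↥(maximalRealSubfield L)) L (IsCMField.complexConj L) 1 (JW (↥(maximalRealSubfield L)) L a)) ⧸
    (UnitaryGroup.toAdelic (↥(maximalRealSubfield L)) L (IsCMField.complexConj L) 1 (JW (↥(maximalRealSubfield L)) L a)).range)]
  [IsFiniteMeasure μW]
  [CompactSpace (adelicGroupData (↥(maximalRealSubfield L)) L (IsCMField.complexConj L) N H).automorphicQuotient]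
  (ν : Measure (adelicGroupData (↥(maximalRealSubfield L)) L (IsCMField.complexConj L) N H).automorphicQuotient) [IsFiniteMeasure ν]
  [SMulInvariantMeasure (adelicGroupData (↥(maximalRealSubfield L)) L (IsCMField.complexConj L) N H).Adelic
    (adelicGroupData (↥(maximalRealSubfield L)) L (IsCMField.complexConj L) N H).automorphicQuotient ν]

include hιA

set_option maxHeartbeats 1600000 in
-- (the line telescope of ★ T2 is large; the rewrites are few)
/-- **A BOOST AT THE INDEFINITE PLACE ACTS ON A HERMITE THETA CLASS THROUGH THE TRANSPORTED HYPERBOLIC FAMILY OF ITS FRAME.**  Let `v₀` be a real place, `(k₊, k₋)`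
a hyperbolic pair there (`hp`, `hm`; `Hp`, `Hm` the same read on the first copy of the doubled datum), `u ∈ U(σ_{w₀} diag dV)(ℂ)` the boost of parameter `t`
of that plane (`hu`), `τ` a type of the splitting character (`hτ`, `hodd`), and `k ∈ U(H)(𝔸)` ANY element with `ιA k = adelicSingle w₀ u`.  Then for every
Hermite multi-index `β` and finite vector `Φ_f`: `R(k) [Θ̃_{E(h^V_β ⊗ Φ_f)}(f) ∘ ιA] = (η_D(k_{v₀,u}) · c) • [Θ̃_{E(((B_t)^{frameV} h^V_β) ⊗ Φ_f)}(f) ∘ ιA]` in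
`L²([U(H)], ν)`, `B_t = reindexEquiv archIdx_V (hypOpEquiv t)` (★ K1 `rightRegular_toLp_lineThetaLift`; ★ the box identity
`carrierConjEquiv_frameD_sectionD_archKPlace_of_boost` + ★ T2 `pairRep_chiSplittingLine_adelicSingle_tmul_of_box`).
[cite: Folland1989, §4.2 (4.24), Prop. (4.39)] [cite: KonnoKonno2007, §3.3, Thm. 5.4] [cite: BorelJacquet1979, §4.1, §4.6] -/
theorem rightRegular_toLp_lineThetaLift_follandHermite_of_boost (v₀ : {v : InfinitePlace (↥(maximalRealSubfield L)) // v.IsReal})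
    {τ : InfinitePlace L → ℤ} (hτ : (toHeckeCharacter L μ).HasUnitaryArchType τ 0) (hodd : ∀ w, Odd (τ w))
    (u : UnitaryGroup.archLocal L N (Matrix.diagonal dV) (cmPlaceOver L v₀)) (t : ℝ) (kp km : Fin n')
    (hp : 0 < signVec (cmPlaceOver L) (cmGramEntry L e₁ dV hdV (lineW L (TW (Fp L) a)) (complexConj_lineW L (TW (Fp L) a))) (imagUnit L) v₀ kp) (hm : ¬0 < signVec (cmPlaceOver L) (cmGramEntry L e₁ dV hdV (lineW L (TW (Fp L) a)) (complexConj_lineW L (TW (Fp L) a))) (imagUnit L) v₀ km)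
    (Hp : 0 < signVec (cmPlaceOver L) (entryD L e₁ dV hdV (lineW L (TW (Fp L) a)) (complexConj_lineW L (TW (Fp L) a))) (imagUnit L) v₀ ((e₂ (n := n')) (Sum.inl kp))) (Hm : ¬0 < signVec (cmPlaceOver L) (entryD L e₁ dV hdV (lineW L (TW (Fp L) a)) (complexConj_lineW L (TW (Fp L) a))) (imagUnit L) v₀ ((e₂ (n := n')) (Sum.inl km)))
    (hu : ∀ i i' : Fin n',
      ((sqrtAbs (signVec (cmPlaceOver L) (cmGramEntry L e₁ dV hdV (lineW L (TW (Fp L) a)) (complexConj_lineW L (TW (Fp L) a))) (imagUnit L) v₀) i : ℝ) : ℂ) *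
          Matrix.reindex e₁ e₁
            ((((u : UnitaryGroup.archLocal L N (Matrix.diagonal dV) (cmPlaceOver L v₀)) : GL (Fin N) ℂ) : Matrix (Fin N) (Fin N) ℂ) ⊗ₖ
              (1 : Matrix (Fin 1) (Fin 1) ℂ)) i i' *
          (((sqrtAbs (signVec (cmPlaceOver L) (cmGramEntry L e₁ dV hdV (lineW L (TW (Fp L) a)) (complexConj_lineW L (TW (Fp L) a))) (imagUnit L) v₀) i' : ℝ) : ℂ))⁻¹ =
        if i = kp then (if i' = kp then (Real.cosh t : ℂ) else if i' = km then -(Real.sinh t : ℂ) * Complex.I else 0)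
        else if i = km then (if i' = kp then (Real.sinh t : ℂ) * Complex.I else if i' = km then (Real.cosh t : ℂ) else 0)
        else if i = i' then 1 else 0)
    (k : (adelicGroupData (↥(maximalRealSubfield L)) L (IsCMField.complexConj L) N H).Adelic)
    (hk : ιA k = UnitaryGroup.adelicSingle (↥(maximalRealSubfield L)) L (IsCMField.complexConj L) N (Matrix.diagonal dV) (IsCMField.complexConj_ne_one L)
      (complexConj_smul_infinitePlace L) (cmPlaceOver L v₀) u)
    (β : (Fin n' × {v : InfinitePlace (↥(maximalRealSubfield L)) // v.IsReal}) →₀ ℕ) (Φf : FinSB (↥(maximalRealSubfield L)) (Fin n')) :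
    (adelicGroupData (↥(maximalRealSubfield L)) L (IsCMField.complexConj L) N H).rightRegular ν k
        (MemLp.toLp _ (memLp_toQuotFun_lineThetaLift L N H e₁ dV hdV hdV0 ιA hιA μ hμ a hρ μW
          (piSchwartzBruhatEquiv (↥(maximalRealSubfield L)) (Fin n') (follandHermite (frameV L e₁ dV hdV hdV0 (lineW L (TW (Fp L) a)) (complexConj_lineW L (TW (Fp L) a)) (lineW_ne_zero L (TW (Fp L) a) (isUnit_det_TW (Fp L) a))) β ⊗ₜ Φf)) f ν 2)) =
      ((((etaD L e₁ dV hdV (lineW L (TW (Fp L) a)) (complexConj_lineW L (TW (Fp L) a)) τ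
            (archKPlace L e₁ dV hdV (lineW L (TW (Fp L) a)) (complexConj_lineW L (TW (Fp L) a)) v₀ u) : ℂˣ) : ℂ)) *
        (vac (weilHomV (Σ v, PosIdx (signVec (cmPlaceOver L) (entryD L e₁ dV hdV (lineW L (TW (Fp L) a)) (complexConj_lineW L (TW (Fp L) a))) (imagUnit L) v)) (Σ v, NegIdx (signVec (cmPlaceOver L) (entryD L e₁ dV hdV (lineW L (TW (Fp L) a)) (complexConj_lineW L (TW (Fp L) a))) (imagUnit L) v)) Unit Empty (hypV ⟨v₀, ⟨(e₂ (n := n')) (Sum.inl kp), Hp⟩⟩ ⟨v₀, ⟨(e₂ (n := n')) (Sum.inl km), Hm⟩⟩ t)) /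
          vacCoeffS (hypOp Unit Empty (⟨v₀, ⟨(e₂ (n := n')) (Sum.inl kp), Hp⟩⟩ : Σ v, PosIdx (signVec (cmPlaceOver L) (entryD L e₁ dV hdV (lineW L (TW (Fp L) a)) (complexConj_lineW L (TW (Fp L) a))) (imagUnit L) v)) (⟨v₀, ⟨(e₂ (n := n')) (Sum.inl km), Hm⟩⟩ : Σ v, NegIdx (signVec (cmPlaceOver L) (entryD L e₁ dV hdV (lineW L (TW (Fp L) a)) (complexConj_lineW L (TW (Fp L) a))) (imagUnit L) v)) t))) •
        MemLp.toLp _ (memLp_toQuotFun_lineThetaLift L N H e₁ dV hdV hdV0 ιA hιA μ hμ a hρ μW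
          (piSchwartzBruhatEquiv (↥(maximalRealSubfield L)) (Fin n') (carrierConjEquiv (frameV L e₁ dV hdV hdV0 (lineW L (TW (Fp L) a)) (complexConj_lineW L (TW (Fp L) a)) (lineW_ne_zero L (TW (Fp L) a) (isUnit_det_TW (Fp L) a))) (MpS.reindexEquiv (archIdx L n' (cmPlaceOver L) (cmGramEntry L e₁ dV hdV (lineW L (TW (Fp L) a)) (complexConj_lineW L (TW (Fp L) a))) (δ := imagUnit L)) (hypOpEquiv Unit Empty (⟨v₀, ⟨kp, hp⟩⟩ : Σ v, PosIdx (signVec (cmPlaceOver L) (cmGramEntry L e₁ dV hdV (lineW L (TW (Fp L) a)) (complexConj_lineW L (TW (Fp L) a))) (imagUnit L) v)) (⟨v₀, ⟨km, hm⟩⟩ : Σ v, NegIdx (signVec (cmPlaceOver L) (cmGramEntry L e₁ dV hdV (lineW L (TW (Fp L) a)) (complexConj_lineW L (TW (Fp L) a))) (imagUnit L) v)) t)) (follandHermite (frameV L e₁ dV hdV hdV0 (lineW L (TW (Fp L) a)) (complexConj_lineW L (TW (Fp L) a)) (lineW_ne_zero L (TW (Fp L) a) (isUnit_det_TW (Fp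 L) a))) β) ⊗ₜ Φf)) f ν 2) := by
  -- the Weil side: `ω((u at w₀), 1) E(h^V_β ⊗ Φ_f) = (η · c) • E((B_t)^{frameV} h^V_β ⊗ Φ_f)` (★ the box identity with `β₂ = 0`)
  have hbox := carrierConjEquiv_frameD_sectionD_archKPlace_of_boost L e₁ dV hdV (lineW L (TW (Fp L) a)) (complexConj_lineW L (TW (Fp L) a)) v₀ hdV0
    (lineW_ne_zero L (TW (Fp L) a) (isUnit_det_TW (Fp L) a)) u t kp km hp hm Hp Hm hu β 0
  -- the equivariance of the class along `ιA`
  have hE := rightRegular_toLp_lineThetaLift L N H e₁ dV hdV hdV0 ιA hιA μ hμ a hρ μW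
    (piSchwartzBruhatEquiv (Fp L) (Fin n') (follandHermite (frameV L e₁ dV hdV hdV0 (lineW L (TW (Fp L) a)) (complexConj_lineW L (TW (Fp L) a)) (lineW_ne_zero L (TW (Fp L) a) (isUnit_det_TW (Fp L) a))) β ⊗ₜ Φf)) f ν k
  rw [hk] at hE
  by_cases hΦf : Φf = 0
  · -- trivial case `Φ_f = 0`: both sides are `0`
    subst hΦf
    have h0 : ∀ φ : 𝓢((Fin n' → mixedEmbedding.mixedSpace (Fp L)), ℂ),
        MemLp.toLp _ (memLp_toQuotFun_lineThetaLift L N H e₁ dV hdV hdV0 ιA hιA μ hμ a hρ μW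
          (piSchwartzBruhatEquiv (Fp L) (Fin n') (φ ⊗ₜ (0 : FinSB (Fp L) (Fin n')))) f ν 2) = 0 := fun φ => by
      rw [TensorProduct.tmul_zero, map_zero, ← zero_smul ℂ (0 : piSchwartzBruhat (Fp L) (Fin n')),
        toLp_lineThetaLift_smul_left L N H e₁ dV hdV hdV0 ιA hιA μ hμ a hρ μW f ν, zero_smul]
    rw [h0, h0, smul_zero]
    exact map_zero _
  have hne : piSchwartzBruhatEquiv (Fp L) (Fin n') (follandHermite (frameV L e₁ dV hdV hdV0 (lineW L (TW (Fp L) a)) (complexConj_lineW L (TW (Fp L) a)) (lineW_ne_zero L (TW (Fp L) a) (isUnit_det_TW (Fp L) a))) 0 ⊗ₜ Φf) ≠ 0 :=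
    piSchwartzBruhatEquiv_tmul_ne_zero (gaussianV_ne_zero L e₁ dV hdV hdV0 _ _ _) hΦf
  have hT2 := pairRep_chiSplittingLine_adelicSingle_tmul_of_box L dV hdV hdV0 v₀ e₁ (isUnitary_toHeckeCharacter L μ)
    ((isOscillatorChar_toHeckeCharacter_iff μ).mpr hμ) hτ hodd (TW (Fp L) a) (isUnit_det_TW (Fp L) a) (JW (Fp L) L a) (JW_eq (Fp L) L a) u hbox Φf hne
  rw [toLp_lineThetaLift_congr L N H e₁ dV hdV hdV0 ιA hιA μ hμ a hρ μW f ν hT2,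
    toLp_lineThetaLift_smul_left L N H e₁ dV hdV hdV0 ιA hιA μ hμ a hρ μW f ν] at hE
  exact hE

set_option maxHeartbeats 1600000 in
/-- **§2 THE FULL-TORUS PROJECTOR EXTRACTS THE BOOSTED HERMITE COEFFICIENT**: with `P_γ = Schur.charProjL μT κ_γ ((rightRegular ν).restrict kT)` the character projector
of the ★ torus hom `kT` and the one-dimensional unitary `κ_γ` of type `c_γ`, and `k`, `u`, `t` as in §1:
`P_γ (R(k) [θ_{h_β ⊗ Φ_f}]) = (η_D(k_{v₀,u}) · c · piCoeff γ (B_t h_β)) • [θ_{h_γ ⊗ Φ_f}]` (§1, ★ `charProjL_thetaClass_eq_coeff_smul_of_hasSum_thetaClass` fed by ★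
`hasSum_follandCoeff_smul_thetaClass_follandHermite`, §2′). [cite: BrockerTomDieck1985, III (5.10)] [cite: Folland1989, §1.7, §4.2 (4.24)] [cite: KonnoKonno2007, Thm. 5.4] -/
theorem charProjL_rightRegular_thetaClass_follandHermite_of_boost (v₀ : {v : InfinitePlace (↥(maximalRealSubfield L)) // v.IsReal})
    {τ : InfinitePlace L → ℤ} (hτ : (toHeckeCharacter L μ).HasUnitaryArchType τ 0) (hodd : ∀ w, Odd (τ w))
    (u : UnitaryGroup.archLocal L N (Matrix.diagonal dV) (cmPlaceOver L v₀)) (t : ℝ) (kp km : Fin n')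
    (hp : 0 < signVec (cmPlaceOver L) (cmGramEntry L e₁ dV hdV (lineW L (TW (Fp L) a)) (complexConj_lineW L (TW (Fp L) a))) (imagUnit L) v₀ kp) (hm : ¬0 < signVec (cmPlaceOver L) (cmGramEntry L e₁ dV hdV (lineW L (TW (Fp L) a)) (complexConj_lineW L (TW (Fp L) a))) (imagUnit L) v₀ km)
    (Hp : 0 < signVec (cmPlaceOver L) (entryD L e₁ dV hdV (lineW L (TW (Fp L) a)) (complexConj_lineW L (TW (Fp L) a))) (imagUnit L) v₀ ((e₂ (n := n')) (Sum.inl kp))) (Hm : ¬0 < signVec (cmPlaceOver L) (entryD L e₁ dV hdV (lineW L (TW (Fp L) a)) (complexConj_lineW L (TW (Fp L) a))) (imagUnit L) v₀ ((e₂ (n := n')) (Sum.inl km)))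
    (hu : ∀ i i' : Fin n',
      ((sqrtAbs (signVec (cmPlaceOver L) (cmGramEntry L e₁ dV hdV (lineW L (TW (Fp L) a)) (complexConj_lineW L (TW (Fp L) a))) (imagUnit L) v₀) i : ℝ) : ℂ) *
          Matrix.reindex e₁ e₁
            ((((u : UnitaryGroup.archLocal L N (Matrix.diagonal dV) (cmPlaceOver L v₀)) : GL (Fin N) ℂ) : Matrix (Fin N) (Fin N) ℂ) ⊗ₖ
              (1 : Matrix (Fin 1) (Fin 1) ℂ)) i i' *
          (((sqrtAbs (signVec (cmPlaceOver L) (cmGramEntry L e₁ dV hdV (lineW L (TW (Fp L) a)) (complexConj_lineW L (TW (Fp L) a))) (imagUnit L) v₀) i' : ℝ) : ℂ))⁻¹ =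
        if i = kp then (if i' = kp then (Real.cosh t : ℂ) else if i' = km then -(Real.sinh t : ℂ) * Complex.I else 0)
        else if i = km then (if i' = kp then (Real.sinh t : ℂ) * Complex.I else if i' = km then (Real.cosh t : ℂ) else 0)
        else if i = i' then 1 else 0)
    (k : (adelicGroupData (↥(maximalRealSubfield L)) L (IsCMField.complexConj L) N H).Adelic)
    (hk : ιA k = UnitaryGroup.adelicSingle (↥(maximalRealSubfield L)) L (IsCMField.complexConj L) N (Matrix.diagonal dV) (IsCMField.complexConj_ne_one L)
      (complexConj_smul_infinitePlace L) (cmPlaceOver L v₀) u)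
    (β γ : (Fin n' × {v : InfinitePlace (↥(maximalRealSubfield L)) // v.IsReal}) →₀ ℕ) (Φf : FinSB (↥(maximalRealSubfield L)) (Fin n'))
    (kT : (({v : InfinitePlace (↥(maximalRealSubfield L)) // v.IsReal}) → Fin N → Circle) →*
      (adelicGroupData (↥(maximalRealSubfield L)) L (IsCMField.complexConj L) N H).Adelic)
    (hkT : ∀ (v : {v : InfinitePlace (↥(maximalRealSubfield L)) // v.IsReal}) (x : Fin N → Circle),
      ιA (kT (Pi.mulSingle v x)) = UnitaryGroup.adelicSingle (↥(maximalRealSubfield L)) L (IsCMField.complexConj L) N (Matrix.diagonal dV)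
        (IsCMField.complexConj_ne_one L) (complexConj_smul_infinitePlace L) (cmPlaceOver L v)
        ⟨circleDiagonal N x, circleDiagonal_mem_archLocal_diagonal L N dV (cmPlaceOver L v) x⟩)
    [MeasurableSpace (({v : InfinitePlace (↥(maximalRealSubfield L)) // v.IsReal}) → Fin N → Circle)] [BorelSpace (({v : InfinitePlace (↥(maximalRealSubfield L)) // v.IsReal}) → Fin N → Circle)]
    (μT : Measure (({v : InfinitePlace (↥(maximalRealSubfield L)) // v.IsReal}) → Fin N → Circle)) [IsProbabilityMeasure μT] [μT.IsMulLeftInvariant]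
    {κ : ContRepresentation ℂ (({v : InfinitePlace (↥(maximalRealSubfield L)) // v.IsReal}) → Fin N → Circle) ℂ}
    (hκ : Continuous (κ : (({v : InfinitePlace (↥(maximalRealSubfield L)) // v.IsReal}) → Fin N → Circle) → ℂ →L[ℂ] ℂ)) [κ.toRepresentation.IsIrreducible]
    (hκu : ∀ (g : (({v : InfinitePlace (↥(maximalRealSubfield L)) // v.IsReal}) → Fin N → Circle)) (x y : ℂ), ⟪κ g x, κ g y⟫_ℂ = ⟪x, y⟫_ℂ)
    (hκc : ∀ z, κ z 1 = (∏ v : {v : InfinitePlace (↥(maximalRealSubfield L)) // v.IsReal}, ∏ p : Fin N, (((z v p : Circle) : ℂ)) ^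
        (if 0 < signVec (cmPlaceOver L) (cmGramEntry L e₁ dV hdV (lineW L (TW (Fp L) a)) (complexConj_lineW L (TW (Fp L) a))) (imagUnit L) v (e₁ (p, 0))
          then (τ (cmPlaceOver L v).1 + 1) / 2 + γ (e₁ (p, 0), v)
          else (τ (cmPlaceOver L v).1 + 1) / 2 - 1 - γ (e₁ (p, 0), v))))
    (hU : ∀ w, Continuous fun z : (({v : InfinitePlace (↥(maximalRealSubfield L)) // v.IsReal}) → Fin N → Circle) => (((adelicGroupData (↥(maximalRealSubfield L)) L (IsCMField.complexConj L) N H).rightRegular ν).restrict kT) z w)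
    (hUu : ∀ (z : (({v : InfinitePlace (↥(maximalRealSubfield L)) // v.IsReal}) → Fin N → Circle)) (w w' : Lp ℂ 2 ν), ⟪(((adelicGroupData (↥(maximalRealSubfield L)) L (IsCMField.complexConj L) N H).rightRegular ν).restrict kT) z w, (((adelicGroupData (↥(maximalRealSubfield L)) L (IsCMField.complexConj L) N H).rightRegular ν).restrict kT) z w'⟫_ℂ = ⟪w, w'⟫_ℂ) :
    Schur.charProjL μT κ (((adelicGroupData (↥(maximalRealSubfield L)) L (IsCMField.complexConj L) N H).rightRegular ν).restrict kT) hκ hκu hU hUu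
        ((adelicGroupData (↥(maximalRealSubfield L)) L (IsCMField.complexConj L) N H).rightRegular ν k
          (MemLp.toLp _ (memLp_toQuotFun_lineThetaLift L N H e₁ dV hdV hdV0 ιA hιA μ hμ a hρ μW
          (piSchwartzBruhatEquiv (↥(maximalRealSubfield L)) (Fin n') (follandHermite (frameV L e₁ dV hdV hdV0 (lineW L (TW (Fp L) a)) (complexConj_lineW L (TW (Fp L) a)) (lineW_ne_zero L (TW (Fp L) a) (isUnit_det_TW (Fp L) a))) β ⊗ₜ Φf)) f ν 2))) =
      (((((etaD L e₁ dV hdV (lineW L (TW (Fp L) a)) (complexConj_lineW L (TW (Fp L) a)) τ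
            (archKPlace L e₁ dV hdV (lineW L (TW (Fp L) a)) (complexConj_lineW L (TW (Fp L) a)) v₀ u) : ℂˣ) : ℂ)) *
        (vac (weilHomV (Σ v, PosIdx (signVec (cmPlaceOver L) (entryD L e₁ dV hdV (lineW L (TW (Fp L) a)) (complexConj_lineW L (TW (Fp L) a))) (imagUnit L) v)) (Σ v, NegIdx (signVec (cmPlaceOver L) (entryD L e₁ dV hdV (lineW L (TW (Fp L) a)) (complexConj_lineW L (TW (Fp L) a))) (imagUnit L) v)) Unit Empty (hypV ⟨v₀, ⟨(e₂ (n := n')) (Sum.inl kp), Hp⟩⟩ ⟨v₀, ⟨(e₂ (n := n')) (Sum.inl km), Hm⟩⟩ t)) /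
          vacCoeffS (hypOp Unit Empty (⟨v₀, ⟨(e₂ (n := n')) (Sum.inl kp), Hp⟩⟩ : Σ v, PosIdx (signVec (cmPlaceOver L) (entryD L e₁ dV hdV (lineW L (TW (Fp L) a)) (complexConj_lineW L (TW (Fp L) a))) (imagUnit L) v)) (⟨v₀, ⟨(e₂ (n := n')) (Sum.inl km), Hm⟩⟩ : Σ v, NegIdx (signVec (cmPlaceOver L) (entryD L e₁ dV hdV (lineW L (TW (Fp L) a)) (complexConj_lineW L (TW (Fp L) a))) (imagUnit L) v)) t))) *
          piCoeff γ ((MpS.reindexEquiv (archIdx L n' (cmPlaceOver L) (cmGramEntry L e₁ dV hdV (lineW L (TW (Fp L) a)) (complexConj_lineW L (TW (Fp L) a))) (δ := imagUnit L)) (hypOpEquiv Unit Empty (⟨v₀, ⟨kp, hp⟩⟩ : Σ v, PosIdx (signVec (cmPlaceOver L) (cmGramEntry L e₁ dV hdV (lineW L (TW (Fp L) a)) (complexConj_lineW L (TW (Fp L) a))) (imagUnit L) v)) (⟨v₀, ⟨km, hm⟩⟩ : Σ v, NegIdx (signVec (cmPlaceOver L) (cmGramEntry L e₁ dV hdV (lineW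 L (TW (Fp L) a)) (complexConj_lineW L (TW (Fp L) a))) (imagUnit L) v)) t)) (hermitePi β))) •
        MemLp.toLp _ (memLp_toQuotFun_lineThetaLift L N H e₁ dV hdV hdV0 ιA hιA μ hμ a hρ μW
          (piSchwartzBruhatEquiv (↥(maximalRealSubfield L)) (Fin n') (follandHermite (frameV L e₁ dV hdV hdV0 (lineW L (TW (Fp L) a)) (complexConj_lineW L (TW (Fp L) a)) (lineW_ne_zero L (TW (Fp L) a) (isUnit_det_TW (Fp L) a))) γ ⊗ₜ Φf)) f ν 2) := by
  rw [rightRegular_toLp_lineThetaLift_follandHermite_of_boost L N H e₁ dV hdV hdV0 ιA hιA μ hμ a hρ μW f ν v₀ hτ hodd u t kp km hp hm Hp Hm hu k hk β Φf]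
  rw [map_smul]
  rw [charProjL_thetaClass_eq_coeff_smul_of_hasSum_thetaClass L N H e₁ dV hdV hdV0 ιA hιA μ hμ a hρ μW f ν hτ hodd γ Φf kT hkT μT hκ hκu hκc hU hUu _ _
      (hasSum_follandCoeff_smul_thetaClass_follandHermite L N H e₁ dV hdV hdV0 ιA hιA μ hμ a hρ μW f ν
        (frameV L e₁ dV hdV hdV0 (lineW L (TW (Fp L) a)) (complexConj_lineW L (TW (Fp L) a)) (lineW_ne_zero L (TW (Fp L) a) (isUnit_det_TW (Fp L) a))) Φf _)]
  simp only [hermiteCoeff_carrierConjEquiv_follandHermite, smul_smul]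

set_option maxHeartbeats 1600000 in
/-- **§3 ONE BOOST STEP OF THE ARCHIMEDEAN LADDER AT THE INDEFINITE PLACE.**  If `Q ⊆ L²([U(H)], ν)` is a closed `R`-invariant subspace containing the Hermite theta
class `[θ_{h_β ⊗ Φ_f}]`, and the boost `B_t` has a non-zero `γ`-th Hermite coefficient on `h_β` (`piCoeff γ (B_t h_β) ≠ 0`), then `[θ_{h_γ ⊗ Φ_f}] ∈ Q`:
`R(k)` and the projector `P_γ` preserve `Q` (★ `charProj_restrict_mem_closedSubrep`) and `P_γ (R(k) [θ_{h_β ⊗ Φ_f}])` is a NON-ZERO multiple of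
`[θ_{h_γ ⊗ Φ_f}]` (§2; `η_D ∈ ℂˣ`, `c ≠ 0` by ★ `vac_weilHomV_hypV_div_vacCoeffS_hypOp_ne_zero`). [cite: Folland1989, §4.4 Thm. (4.37), Ch. 4 §5]
[cite: KashiwaraVergne1978, §6] [cite: Howe1989, §3] -/
theorem thetaClass_follandHermite_mem_of_boostCoeff_ne_zero (v₀ : {v : InfinitePlace (↥(maximalRealSubfield L)) // v.IsReal})
    {τ : InfinitePlace L → ℤ} (hτ : (toHeckeCharacter L μ).HasUnitaryArchType τ 0) (hodd : ∀ w, Odd (τ w))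
    (u : UnitaryGroup.archLocal L N (Matrix.diagonal dV) (cmPlaceOver L v₀)) (t : ℝ) (kp km : Fin n')
    (hp : 0 < signVec (cmPlaceOver L) (cmGramEntry L e₁ dV hdV (lineW L (TW (Fp L) a)) (complexConj_lineW L (TW (Fp L) a))) (imagUnit L) v₀ kp) (hm : ¬0 < signVec (cmPlaceOver L) (cmGramEntry L e₁ dV hdV (lineW L (TW (Fp L) a)) (complexConj_lineW L (TW (Fp L) a))) (imagUnit L) v₀ km)
    (Hp : 0 < signVec (cmPlaceOver L) (entryD L e₁ dV hdV (lineW L (TW (Fp L) a)) (complexConj_lineW L (TW (Fp L) a))) (imagUnit L) v₀ ((e₂ (n := n')) (Sum.inl kp))) (Hm : ¬0 < signVec (cmPlaceOver L) (entryD L e₁ dV hdV (lineW L (TW (Fp L) a)) (complexConj_lineW L (TW (Fp L) a))) (imagUnit L) v₀ ((e₂ (n := n')) (Sum.inl km)))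
    (hu : ∀ i i' : Fin n',
      ((sqrtAbs (signVec (cmPlaceOver L) (cmGramEntry L e₁ dV hdV (lineW L (TW (Fp L) a)) (complexConj_lineW L (TW (Fp L) a))) (imagUnit L) v₀) i : ℝ) : ℂ) *
          Matrix.reindex e₁ e₁
            ((((u : UnitaryGroup.archLocal L N (Matrix.diagonal dV) (cmPlaceOver L v₀)) : GL (Fin N) ℂ) : Matrix (Fin N) (Fin N) ℂ) ⊗ₖ
              (1 : Matrix (Fin 1) (Fin 1) ℂ)) i i' *
          (((sqrtAbs (signVec (cmPlaceOver L) (cmGramEntry L e₁ dV hdV (lineW L (TW (Fp L) a)) (complexConj_lineW L (TW (Fp L) a))) (imagUnit L) v₀) i' : ℝ) : ℂ))⁻¹ =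
        if i = kp then (if i' = kp then (Real.cosh t : ℂ) else if i' = km then -(Real.sinh t : ℂ) * Complex.I else 0)
        else if i = km then (if i' = kp then (Real.sinh t : ℂ) * Complex.I else if i' = km then (Real.cosh t : ℂ) else 0)
        else if i = i' then 1 else 0)
    (k : (adelicGroupData (↥(maximalRealSubfield L)) L (IsCMField.complexConj L) N H).Adelic)
    (hk : ιA k = UnitaryGroup.adelicSingle (↥(maximalRealSubfield L)) L (IsCMField.complexConj L) N (Matrix.diagonal dV) (IsCMField.complexConj_ne_one L)
      (complexConj_smul_infinitePlace L) (cmPlaceOver L v₀) u)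
    (β γ : (Fin n' × {v : InfinitePlace (↥(maximalRealSubfield L)) // v.IsReal}) →₀ ℕ) (Φf : FinSB (↥(maximalRealSubfield L)) (Fin n'))
    (hne : piCoeff γ ((MpS.reindexEquiv (archIdx L n' (cmPlaceOver L) (cmGramEntry L e₁ dV hdV (lineW L (TW (Fp L) a)) (complexConj_lineW L (TW (Fp L) a))) (δ := imagUnit L)) (hypOpEquiv Unit Empty (⟨v₀, ⟨kp, hp⟩⟩ : Σ v, PosIdx (signVec (cmPlaceOver L) (cmGramEntry L e₁ dV hdV (lineW L (TW (Fp L) a)) (complexConj_lineW L (TW (Fp L) a))) (imagUnit L) v)) (⟨v₀, ⟨km, hm⟩⟩ : Σ v, NegIdx (signVec (cmPlaceOver L) (cmGramEntry L e₁ dV hdV (lineW L (TW (Fp L) a)) (complexConj_lineW L (TW (Fp L) a))) (imagUnit L) v)) t)) (hermitePi β)) ≠ 0)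
    (kT : (({v : InfinitePlace (↥(maximalRealSubfield L)) // v.IsReal}) → Fin N → Circle) →*
      (adelicGroupData (↥(maximalRealSubfield L)) L (IsCMField.complexConj L) N H).Adelic)
    (hkT : ∀ (v : {v : InfinitePlace (↥(maximalRealSubfield L)) // v.IsReal}) (x : Fin N → Circle),
      ιA (kT (Pi.mulSingle v x)) = UnitaryGroup.adelicSingle (↥(maximalRealSubfield L)) L (IsCMField.complexConj L) N (Matrix.diagonal dV)
        (IsCMField.complexConj_ne_one L) (complexConj_smul_infinitePlace L) (cmPlaceOver L v)
        ⟨circleDiagonal N x, circleDiagonal_mem_archLocal_diagonal L N dV (cmPlaceOver L v) x⟩)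
    [MeasurableSpace (({v : InfinitePlace (↥(maximalRealSubfield L)) // v.IsReal}) → Fin N → Circle)] [BorelSpace (({v : InfinitePlace (↥(maximalRealSubfield L)) // v.IsReal}) → Fin N → Circle)]
    (μT : Measure (({v : InfinitePlace (↥(maximalRealSubfield L)) // v.IsReal}) → Fin N → Circle)) [IsProbabilityMeasure μT] [μT.IsMulLeftInvariant]
    {κ : ContRepresentation ℂ (({v : InfinitePlace (↥(maximalRealSubfield L)) // v.IsReal}) → Fin N → Circle) ℂ}
    (hκ : Continuous (κ : (({v : InfinitePlace (↥(maximalRealSubfield L)) // v.IsReal}) → Fin N → Circle) → ℂ →L[ℂ] ℂ)) [κ.toRepresentation.IsIrreducible]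
    (hκu : ∀ (g : (({v : InfinitePlace (↥(maximalRealSubfield L)) // v.IsReal}) → Fin N → Circle)) (x y : ℂ), ⟪κ g x, κ g y⟫_ℂ = ⟪x, y⟫_ℂ)
    (hκc : ∀ z, κ z 1 = (∏ v : {v : InfinitePlace (↥(maximalRealSubfield L)) // v.IsReal}, ∏ p : Fin N, (((z v p : Circle) : ℂ)) ^
        (if 0 < signVec (cmPlaceOver L) (cmGramEntry L e₁ dV hdV (lineW L (TW (Fp L) a)) (complexConj_lineW L (TW (Fp L) a))) (imagUnit L) v (e₁ (p, 0))
          then (τ (cmPlaceOver L v).1 + 1) / 2 + γ (e₁ (p, 0), v)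
          else (τ (cmPlaceOver L v).1 + 1) / 2 - 1 - γ (e₁ (p, 0), v))))
    (hU : ∀ w, Continuous fun z : (({v : InfinitePlace (↥(maximalRealSubfield L)) // v.IsReal}) → Fin N → Circle) => (((adelicGroupData (↥(maximalRealSubfield L)) L (IsCMField.complexConj L) N H).rightRegular ν).restrict kT) z w)
    (hUu : ∀ (z : (({v : InfinitePlace (↥(maximalRealSubfield L)) // v.IsReal}) → Fin N → Circle)) (w w' : Lp ℂ 2 ν), ⟪(((adelicGroupData (↥(maximalRealSubfield L)) L (IsCMField.complexConj L) N H).rightRegular ν).restrict kT) z w, (((adelicGroupData (↥(maximalRealSubfield L)) L (IsCMField.complexConj L) N H).rightRegular ν).restrict kT) z w'⟫_ℂ = ⟪w, w'⟫_ℂ)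
    (Q : ContRepresentation.ClosedSubrep ((adelicGroupData (↥(maximalRealSubfield L)) L (IsCMField.complexConj L) N H).rightRegular ν))
    (hQ : MemLp.toLp _ (memLp_toQuotFun_lineThetaLift L N H e₁ dV hdV hdV0 ιA hιA μ hμ a hρ μW
          (piSchwartzBruhatEquiv (↥(maximalRealSubfield L)) (Fin n') (follandHermite (frameV L e₁ dV hdV hdV0 (lineW L (TW (Fp L) a)) (complexConj_lineW L (TW (Fp L) a)) (lineW_ne_zero L (TW (Fp L) a) (isUnit_det_TW (Fp L) a))) β ⊗ₜ Φf)) f ν 2) ∈ Q) :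
    MemLp.toLp _ (memLp_toQuotFun_lineThetaLift L N H e₁ dV hdV hdV0 ιA hιA μ hμ a hρ μW
          (piSchwartzBruhatEquiv (↥(maximalRealSubfield L)) (Fin n') (follandHermite (frameV L e₁ dV hdV hdV0 (lineW L (TW (Fp L) a)) (complexConj_lineW L (TW (Fp L) a)) (lineW_ne_zero L (TW (Fp L) a) (isUnit_det_TW (Fp L) a))) γ ⊗ₜ Φf)) f ν 2) ∈ Q := by
  -- `R(k)` and `P_γ` preserve `Q`
  have h1 := Q.apply_mem k hQ
  have h2 : Schur.charProjL μT κ (((adelicGroupData (↥(maximalRealSubfield L)) L (IsCMField.complexConj L) N H).rightRegular ν).restrict kT) hκ hκu hU hUu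
      ((adelicGroupData (↥(maximalRealSubfield L)) L (IsCMField.complexConj L) N H).rightRegular ν k
        (MemLp.toLp _ (memLp_toQuotFun_lineThetaLift L N H e₁ dV hdV hdV0 ιA hιA μ hμ a hρ μW
          (piSchwartzBruhatEquiv (↥(maximalRealSubfield L)) (Fin n') (follandHermite (frameV L e₁ dV hdV hdV0 (lineW L (TW (Fp L) a)) (complexConj_lineW L (TW (Fp L) a)) (lineW_ne_zero L (TW (Fp L) a) (isUnit_det_TW (Fp L) a))) β ⊗ₜ Φf)) f ν 2))) ∈ Q := by
    rw [Schur.charProjL_apply]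
    exact charProj_restrict_mem_closedSubrep μT hκ _ kT hU Q h1
  rw [charProjL_rightRegular_thetaClass_follandHermite_of_boost L N H e₁ dV hdV hdV0 ιA hιA μ hμ a hρ μW f ν v₀ hτ hodd u t kp km hp hm Hp Hm hu k hk β γ Φf kT hkT μT hκ
    hκu hκc hU hUu] at h2
  -- a non-zero multiple
  have hc : ((((etaD L e₁ dV hdV (lineW L (TW (Fp L) a)) (complexConj_lineW L (TW (Fp L) a)) τ
            (archKPlace L e₁ dV hdV (lineW L (TW (Fp L) a)) (complexConj_lineW L (TW (Fp L) a)) v₀ u) : ℂˣ) : ℂ)) *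
        (vac (weilHomV (Σ v, PosIdx (signVec (cmPlaceOver L) (entryD L e₁ dV hdV (lineW L (TW (Fp L) a)) (complexConj_lineW L (TW (Fp L) a))) (imagUnit L) v)) (Σ v, NegIdx (signVec (cmPlaceOver L) (entryD L e₁ dV hdV (lineW L (TW (Fp L) a)) (complexConj_lineW L (TW (Fp L) a))) (imagUnit L) v)) Unit Empty (hypV ⟨v₀, ⟨(e₂ (n := n')) (Sum.inl kp), Hp⟩⟩ ⟨v₀, ⟨(e₂ (n := n')) (Sum.inl km), Hm⟩⟩ t)) /
          vacCoeffS (hypOp Unit Empty (⟨v₀, ⟨(e₂ (n := n')) (Sum.inl kp), Hp⟩⟩ : Σ v, PosIdx (signVec (cmPlaceOver L) (entryD L e₁ dV hdV (lineW L (TW (Fp L) a)) (complexConj_lineW L (TW (Fp L) a))) (imagUnit L) v)) (⟨v₀, ⟨(e₂ (n := n')) (Sum.inl km), Hm⟩⟩ : Σ v, NegIdx (signVec (cmPlaceOver L) (entryD L e₁ dV hdV (lineW L (TW (Fp L) a)) (complexConj_lineW L (TW (Fp L) a))) (imagUnit L) v)) t))) *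
          piCoeff γ ((MpS.reindexEquiv (archIdx L n' (cmPlaceOver L) (cmGramEntry L e₁ dV hdV (lineW L (TW (Fp L) a)) (complexConj_lineW L (TW (Fp L) a))) (δ := imagUnit L)) (hypOpEquiv Unit Empty (⟨v₀, ⟨kp, hp⟩⟩ : Σ v, PosIdx (signVec (cmPlaceOver L) (cmGramEntry L e₁ dV hdV (lineW L (TW (Fp L) a)) (complexConj_lineW L (TW (Fp L) a))) (imagUnit L) v)) (⟨v₀, ⟨km, hm⟩⟩ : Σ v, NegIdx (signVec (cmPlaceOver L) (cmGramEntry L e₁ dV hdV (lineW L (TW (Fp L) a)) (complexConj_lineW L (TW (Fp L) a))) (imagUnit L) v)) t)) (hermitePi β)) ≠ 0 :=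
    mul_ne_zero (mul_ne_zero (Units.ne_zero _) (vac_weilHomV_hypV_div_vacCoeffS_hypOp_ne_zero Unit Empty _ _ t)) hne
  have h3 := Q.toSubmodule.smul_mem (((((etaD L e₁ dV hdV (lineW L (TW (Fp L) a)) (complexConj_lineW L (TW (Fp L) a)) τ
            (archKPlace L e₁ dV hdV (lineW L (TW (Fp L) a)) (complexConj_lineW L (TW (Fp L) a)) v₀ u) : ℂˣ) : ℂ)) *
        (vac (weilHomV (Σ v, PosIdx (signVec (cmPlaceOver L) (entryD L e₁ dV hdV (lineW L (TW (Fp L) a)) (complexConj_lineW L (TW (Fp L) a))) (imagUnit L) v)) (Σ v, NegIdx (signVec (cmPlaceOver L) (entryD L e₁ dV hdV (lineW L (TW (Fp L) a)) (complexConj_lineW L (TW (Fp L) a))) (imagUnit L) v)) Unit Empty (hypV ⟨v₀, ⟨(e₂ (n := n')) (Sum.inl kp), Hp⟩⟩ ⟨v₀, ⟨(e₂ (n := n')) (Sum.inl km), Hm⟩⟩ t)) /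
          vacCoeffS (hypOp Unit Empty (⟨v₀, ⟨(e₂ (n := n')) (Sum.inl kp), Hp⟩⟩ : Σ v, PosIdx (signVec (cmPlaceOver L) (entryD L e₁ dV hdV (lineW L (TW (Fp L) a)) (complexConj_lineW L (TW (Fp L) a))) (imagUnit L) v)) (⟨v₀, ⟨(e₂ (n := n')) (Sum.inl km), Hm⟩⟩ : Σ v, NegIdx (signVec (cmPlaceOver L) (entryD L e₁ dV hdV (lineW L (TW (Fp L) a)) (complexConj_lineW L (TW (Fp L) a))) (imagUnit L) v)) t))) *
          piCoeff γ ((MpS.reindexEquiv (archIdx L n' (cmPlaceOver L) (cmGramEntry L e₁ dV hdV (lineW L (TW (Fp L) a)) (complexConj_lineW L (TW (Fp L) a))) (δ := imagUnit L)) (hypOpEquiv Unit Empty (⟨v₀, ⟨kp, hp⟩⟩ : Σ v, PosIdx (signVec (cmPlaceOver L) (cmGramEntry L e₁ dV hdV (lineW L (TW (Fp L) a)) (complexConj_lineW L (TW (Fp L) a))) (imagUnit L) v)) (⟨v₀, ⟨km, hm⟩⟩ : Σ v, NegIdx (signVec (cmPlaceOver L) (cmGramEntry L e₁ dV hdV (lineW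 L (TW (Fp L) a)) (complexConj_lineW L (TW (Fp L) a))) (imagUnit L) v)) t)) (hermitePi β)))⁻¹ h2
  rwa [smul_smul, inv_mul_cancel₀ hc, one_smul] at h3

end Covariance

end Summit.HodgeConjecture.HodgeConjecture.Cruxes.HLiu418.F0LD1ThetaArchLadderIotaStep

end
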